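import Summits.CriticalPhenomena.PercolationContinuityZ3.Theorems.PercNearOneGluingNoHeavyLowerTailSahiE3ExchangeCross
import Mathlib.Tactic.Linarith
import Mathlib.Tactic.Ring
import Mathlib.Tactic.Positivity
import HarnessLib
import HarnessLib.Audit

/-!
# `NoHeavyLowerTail` (crux stmt-CriticalPhenomena-4575), Sahi programme P4: OR-peel of the flagship — level `z₂`, the Bernstein coefficient `c₂(D₂)`, generic (crossing-free) branch

Support file (cell `prim-l12`, seat P4, generation 24; `--supports stmt-CriticalPhenomena-4575`).  No named facts, no sorries;
standard axioms; def-free.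

Context (HOME prim-l12-p4/FROM-prim-l12-p4-gen24-LEVEL-Z2-STRUCTURE.md; predecessors `…SahiE3ExchangeCross` (level `∅`),
`…SahiE3ExchangeGTrue` (`c₃ ≥ 0`)).  At level `(Q',G') = (Bool_{z₂}, {z₂})` of the OR-peel the difference `D₂` is a cubic in
`p₂ = P(z₂)` whose Bernstein coefficients `c₃, c₂, c₁, c₀` are functions of a pair of TWO-COLUMN configurations
`O^t ⊆ K^t ∩ L^t`, `K^t ∪ L^t ⊆ P^t` (`t = 0,1` the `z₂`-layers, `X⁰ ⊆ X¹`) of up-sets of a Harris block `(B, w, V)` and of the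
certificate `R` of `V`.  This file proves the GENERIC branch of `c₂(D₂) ≥ 0` for an ARBITRARY block: writing
`Σ = (O⁰, K⁰, L¹, P¹)` (a valid one-column configuration), the exact identity
  `c₂(D₂) = EXCH₂(Σ;Σ') + POS + PW`
holds, where `EXCH₂(Σ;Σ')` is the level-`∅` exchange expression of the configuration pair `(Σ, Σ')` (nonnegative by the
level-`∅` theorem, e.g. `…SahiE3AndOrExch2.exch2_andor` for the flagship block), `POS` is a nonnegative combination of ten
Harris slacks and five products of nested mass differences, and
  `PW = v·w((P¹P'¹ ∖ P⁰P'⁰) ∖ V) + Σ_{x∈V} w(x)[(κ₁−λ₀)(κ'₁−λ'₀) + (κ₁−λ₁)(κ'₁−λ'₁) + (2−v)(π₀−o₁)(π'₀−o'₁) + v(π₁−o₁)(π'₁−o'₁)]`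
(indicators of `K¹, L⁰, L¹, P⁰, P¹, O¹` and primed) is nonnegative as soon as `V` contains no crossing point of the three
kinds `(K¹∖L⁰)(L'⁰∖K'¹)`, `(K¹∖L¹)(L'¹∖K'¹)`, `(O¹∖P⁰)(P'⁰∖O'¹)` (and mirror images).  THEOREM `c2_ge_exch_of_noCross`:
under these emptiness hypotheses, the Harris inequalities at the ten pairs and the nestings, `EXCH₂(Σ;Σ') ≤ c₂(D₂)`.
The identity and the certificate were found by an LP over pointwise Harris certificates and verified in exact arithmetic
(HOME lab/plp*.py, z2c2id.c).
-/

namespace Summit.CriticalPhenomena.PercolationContinuityZ3.Theorems.SahiE3LevelZ2C2Generic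

open Finset SahiE3ExchangeCross
open scoped BigOperators

variable {B : Type*} [DecidableEq B]

/-- Difference of a set-sum and its `V`-part is monotone in the set (for a nonnegative weight): the mass outside `V`
of `X ⊆ Y` is at most that of `Y`. [folklore] -/
theorem sum_sub_inter_mono (w : B → ℝ) (hw : ∀ b, 0 ≤ w b) (V : Finset B) {X Y : Finset B} (h : X ⊆ Y) :
    ∑ b ∈ X, w b - ∑ b ∈ X ∩ V, w b ≤ ∑ b ∈ Y, w b - ∑ b ∈ Y ∩ V, w b := by
  have hX := Finset.sum_sdiff (f := w) (Finset.inter_subset_left (s₁ := X) (s₂ := V))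
  have hY := Finset.sum_sdiff (f := w) (Finset.inter_subset_left (s₁ := Y) (s₂ := V))
  have hsub : X \ (X ∩ V) ⊆ Y \ (Y ∩ V) := by
    intro b hb
    rw [Finset.mem_sdiff, Finset.mem_inter] at hb ⊢
    exact ⟨h hb.1, fun hh => hb.2 ⟨hb.1, hh.2⟩⟩
  have := Finset.sum_le_sum_of_subset_of_nonneg hsub (f := w) (fun b _ _ => hw b)
  linarith

/-- **Level `z₂`, coefficient `c₂(D₂)`, generic branch** (see the module docstring): for a finite type `B` with a weight
`w ≥ 0` of total mass `1`, a slot `V`, any `R`, two-column configurations `O^t ⊆ K^t, L^t ⊆ P^t`, `X⁰ ⊆ X¹` (unprimed and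
primed), the ten Harris inequalities listed, and no crossing point in `V` of the kinds `(K¹,L⁰;K'¹,L'⁰)`, `(K¹,L¹;K'¹,L'¹)`,
`(O¹,P⁰;O'¹,P'⁰)`: the level-`∅` exchange expression of `Σ = (O⁰,K⁰,L¹,P¹)`, `Σ' = (O'⁰,K'⁰,L'¹,P'¹)` is at most `c₂(D₂)`.
[this work] -/
theorem c2_ge_exch_of_noCross [Fintype B] (w R : B → ℝ) (hw : ∀ b, 0 ≤ w b) (hw1 : ∑ b, w b = 1)
    (V P₀ K₀ L₀ O₀ P₁ K₁ L₁ O₁ P₀' K₀' L₀' O₀' P₁' K₁' L₁' O₁' : Finset B)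
    (hOK₁ : O₁ ⊆ K₁) (hKP₁ : K₁ ⊆ P₁) (hOP₁ : O₁ ⊆ P₁) (hP₀₁ : P₀ ⊆ P₁)
    (hOK₁' : O₁' ⊆ K₁') (hKP₁' : K₁' ⊆ P₁') (hOP₁' : O₁' ⊆ P₁') (hP₀₁' : P₀' ⊆ P₁')
    (hΞa : ((K₁ \ L₀) ∩ (L₀' \ K₁')) ∩ V = ∅) (hΞb : ((L₀ \ K₁) ∩ (K₁' \ L₀')) ∩ V = ∅)
    (hΞc : ((K₁ \ L₁) ∩ (L₁' \ K₁')) ∩ V = ∅) (hΞd : ((L₁ \ K₁) ∩ (K₁' \ L₁')) ∩ V = ∅)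
    (hΞe : ((P₀ \ O₁) ∩ (O₁' \ P₀')) ∩ V = ∅) (hΞf : ((O₁ \ P₀) ∩ (P₀' \ O₁')) ∩ V = ∅)
    (hH1 : (∑ b ∈ K₁, w b) * (∑ b ∈ K₁', w b) ≤ ∑ b ∈ K₁ ∩ K₁', w b)
    (hH2 : (∑ b ∈ K₁, w b) * (∑ b ∈ L₀' ∩ V, w b) ≤ ∑ b ∈ (K₁ ∩ L₀') ∩ V, w b)
    (hH3 : (∑ b ∈ K₁, w b) * (∑ b ∈ L₁' ∩ V, w b) ≤ ∑ b ∈ (K₁ ∩ L₁') ∩ V, w b)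
    (hH4 : (∑ b ∈ K₁', w b) * (∑ b ∈ L₀ ∩ V, w b) ≤ ∑ b ∈ (L₀ ∩ K₁') ∩ V, w b)
    (hH5 : (∑ b ∈ K₁', w b) * (∑ b ∈ L₁ ∩ V, w b) ≤ ∑ b ∈ (L₁ ∩ K₁') ∩ V, w b)
    (hH6 : (∑ b ∈ P₀, w b) * (∑ b ∈ O₁' ∩ V, w b) ≤ ∑ b ∈ (P₀ ∩ O₁') ∩ V, w b)
    (hH7 : (∑ b ∈ P₀', w b) * (∑ b ∈ O₁ ∩ V, w b) ≤ ∑ b ∈ (O₁ ∩ P₀') ∩ V, w b)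
    (hH8 : (∑ b ∈ P₁, w b) * (∑ b ∈ O₁' ∩ V, w b) ≤ ∑ b ∈ (P₁ ∩ O₁') ∩ V, w b)
    (hH9 : (∑ b ∈ P₁', w b) * (∑ b ∈ O₁ ∩ V, w b) ≤ ∑ b ∈ (O₁ ∩ P₁') ∩ V, w b)
    (hH10 : (∑ b ∈ P₁, w b) * (∑ b ∈ P₁', w b) ≤ ∑ b ∈ P₁ ∩ P₁', w b) :
    (∑ b ∈ V, w b)*(∑ b ∈ L₁, w b)*(∑ b ∈ P₁', w b) + (∑ b ∈ V, w b)*(∑ b ∈ K₀, w b)*(∑ b ∈ P₁', w b) + (∑ b ∈ V, w b)*(∑ b ∈ P₁, w b)*(∑ b ∈ L₁', w b) + (∑ b ∈ V, w b)*(∑ b ∈ P₁, w b)*(∑ b ∈ K₀', w b) - ((∑ b ∈ V, w b)*(∑ b ∈ P₁, w b)*(∑ b ∈ P₁', w b)) - ((∑ b ∈ O₀ ∩ V, w b)*(∑ b ∈ P₁', w b)) - ((∑ b ∈ L₁ ∩ V, w b)*(∑ b ∈ K₀', w b)) - ((∑ b ∈ L₁, w b)*(∑ b ∈ K₀' ∩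 V, w b)) + (∑ b ∈ L₁, w b)*(∑ b ∈ K₀', w b) - ((∑ b ∈ L₁, w b)*(∑ b ∈ P₁', w b)) - ((∑ b ∈ K₀ ∩ V, w b)*(∑ b ∈ L₁', w b)) - ((∑ b ∈ K₀, w b)*(∑ b ∈ L₁' ∩ V, w b)) + (∑ b ∈ K₀, w b)*(∑ b ∈ L₁', w b) - ((∑ b ∈ K₀, w b)*(∑ b ∈ P₁', w b)) - ((∑ b ∈ P₁, w b)*(∑ b ∈ O₀' ∩ V, w b)) - ((∑ b ∈ P₁, w b)*(∑ b ∈ L₁', w b)) - ((∑ b ∈ P₁, w b)*(∑ b ∈ K₀', w b)) + (∑ b ∈ P₁, w b)*(∑ b ∈ P₁', w b) - ((∑ b ∈ V, w b)*(∑ b ∈ P₁ ∩ P₁', w b)) + (∑ b ∈ (O₀ ∩ O₀') ∩ V, w b) + (∑ b ∈ (L₁ ∩ L₁') ∩ V, R b) + (∑ b ∈ (K₀ ∩ K₀') ∩ V, R b) + (∑ b ∈ P₁ ∩ P₁', w b) + (∑ b ∈ (P₁ ∩ P₁') ∩ V, w b)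
      ≤ (∑ b ∈ V, w b)*(∑ b ∈ L₁, w b)*(∑ b ∈ P₁', w b) + (∑ b ∈ V, w b)*(∑ b ∈ K₁, w b)*(∑ b ∈ P₁', w b) + (∑ b ∈ V, w b)*(∑ b ∈ K₁, w b)*(∑ b ∈ P₀', w b) + (∑ b ∈ V, w b)*(∑ b ∈ K₀, w b)*(∑ b ∈ P₁', w b) + (∑ b ∈ V, w b)*(∑ b ∈ P₁, w b)*(∑ b ∈ L₁', w b) + (∑ b ∈ V, w b)*(∑ b ∈ P₁, w b)*(∑ b ∈ K₁', w b) + (∑ b ∈ V, w b)*(∑ b ∈ P₁, w b)*(∑ b ∈ K₀', w b) - ((∑ b ∈ V, w b)*(∑ b ∈ P₁, w b)*(∑ b ∈ P₁', w b)) + (∑ b ∈ V, w b)*(∑ b ∈ P₀, w b)*(∑ b ∈ K₁', w b) - ((∑ b ∈ O₁ ∩ V, w b)*(∑ b ∈ P₁', w b)) - ((∑ b ∈ O₁ ∩ V, w b)*(∑ b ∈ P₀', w b)) - ((∑ b ∈ O₀ ∩ V, w b)*(∑ b ∈ P₁', w b)) - ((∑ b ∈ L₁ ∩ V, w b)*(∑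 b ∈ K₁', w b)) - ((∑ b ∈ L₁ ∩ V, w b)*(∑ b ∈ K₀', w b)) - ((∑ b ∈ L₁, w b)*(∑ b ∈ K₀' ∩ V, w b)) + (∑ b ∈ L₁, w b)*(∑ b ∈ K₀', w b) - ((∑ b ∈ L₁, w b)*(∑ b ∈ P₁', w b)) - ((∑ b ∈ L₀ ∩ V, w b)*(∑ b ∈ K₁', w b)) - ((∑ b ∈ K₁, w b)*(∑ b ∈ L₁' ∩ V, w b)) - ((∑ b ∈ K₁, w b)*(∑ b ∈ L₀' ∩ V, w b)) - ((∑ b ∈ K₁, w b)*(∑ b ∈ P₁', w b)) - ((∑ b ∈ K₁, w b)*(∑ b ∈ P₀', w b)) - ((∑ b ∈ K₀ ∩ V, w b)*(∑ b ∈ L₁', w b)) - ((∑ b ∈ K₀, w b)*(∑ b ∈ L₁' ∩ V, w b)) + (∑ b ∈ K₀, w b)*(∑ b ∈ L₁', w b) - ((∑ b ∈ K₀, w b)*(∑ b ∈ P₁', w b)) - ((∑ b ∈ P₁, w b)*(∑ b ∈ O₁' ∩ V, w b)) - ((∑ b ∈ P₁, w b)*(∑ b ∈ O₀' ∩ V,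 w b)) - ((∑ b ∈ P₁, w b)*(∑ b ∈ L₁', w b)) - ((∑ b ∈ P₁, w b)*(∑ b ∈ K₁', w b)) - ((∑ b ∈ P₁, w b)*(∑ b ∈ K₀', w b)) + (∑ b ∈ P₁, w b)*(∑ b ∈ P₁', w b) - ((∑ b ∈ P₀, w b)*(∑ b ∈ O₁' ∩ V, w b)) - ((∑ b ∈ P₀, w b)*(∑ b ∈ K₁', w b)) + (-2 : ℝ)*(∑ b ∈ V, w b)*(∑ b ∈ K₁ ∩ K₁', w b) + (-2 : ℝ)*(∑ b ∈ V, w b)*(∑ b ∈ P₁ ∩ P₁', w b) - ((∑ b ∈ V, w b)*(∑ b ∈ P₀ ∩ P₀', w b)) + (2 : ℝ)*(∑ b ∈ (O₁ ∩ O₁') ∩ V, w b) + (∑ b ∈ (O₀ ∩ O₀') ∩ V, w b) + (∑ b ∈ (L₁ ∩ L₁') ∩ V, R b) + (∑ b ∈ (L₁ ∩ L₁') ∩ V, w b) + (∑ b ∈ (L₀ ∩ L₀') ∩ V, w b) + (∑ b ∈ (K₀ ∩ K₀') ∩ V, R b) + (2 : ℝ)*(∑ b ∈ K₁ ∩ K₁',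 w b) + (2 : ℝ)*(∑ b ∈ (K₁ ∩ K₁') ∩ V, w b) + (3 : ℝ)*(∑ b ∈ P₁ ∩ P₁', w b) + (∑ b ∈ (P₁ ∩ P₁') ∩ V, w b) + (2 : ℝ)*(∑ b ∈ (P₀ ∩ P₀') ∩ V, w b) := by
  -- pointwise facts
  have hwV : ∀ b ∈ V, 0 ≤ w b := fun b _ => hw b
  have hx1 := cross_le_same_of_noCross w V K₁ L₀ K₁' L₀' hwV hΞa hΞb
  have hx2 := cross_le_same_of_noCross w V K₁ L₁ K₁' L₁' hwV hΞc hΞd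
  have hx3 := cross_le_same_of_noCross w V P₀ O₁ P₀' O₁' hwV hΞe hΞf
  have hmd := modularity_nested w V P₁ O₁ P₁' O₁' hwV hOP₁ hOP₁'
  have hc := sum_sub_inter_mono w hw V (Finset.inter_subset_inter hP₀₁ hP₀₁')
  -- scalar facts
  have hv0 : 0 ≤ ∑ b ∈ V, w b := Finset.sum_nonneg fun b _ => hw b
  have hv1 : ∑ b ∈ V, w b ≤ 1 := by rw [← hw1]; exact sum_le_sum_of_subset' w hw (Finset.subset_univ V)
  have hko : ∑ b ∈ O₁, w b ≤ ∑ b ∈ K₁, w b := sum_le_sum_of_subset' w hw hOK₁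
  have hkp : ∑ b ∈ K₁, w b ≤ ∑ b ∈ P₁, w b := sum_le_sum_of_subset' w hw hKP₁
  have hpp : ∑ b ∈ P₀, w b ≤ ∑ b ∈ P₁, w b := sum_le_sum_of_subset' w hw hP₀₁
  have hko' : ∑ b ∈ O₁', w b ≤ ∑ b ∈ K₁', w b := sum_le_sum_of_subset' w hw hOK₁'
  have hkp' : ∑ b ∈ K₁', w b ≤ ∑ b ∈ P₁', w b := sum_le_sum_of_subset' w hw hKP₁'
  have hpp' : ∑ b ∈ P₀', w b ≤ ∑ b ∈ P₁', w b := sum_le_sum_of_subset' w hw hP₀₁'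
  have hoa : ∑ b ∈ O₁ ∩ V, w b ≤ ∑ b ∈ O₁, w b := sum_le_sum_of_subset' w hw Finset.inter_subset_left
  have hoa' : ∑ b ∈ O₁' ∩ V, w b ≤ ∑ b ∈ O₁', w b := sum_le_sum_of_subset' w hw Finset.inter_subset_left
  -- the fifteen nonnegative products of the certificate
  have e1 : 0 ≤ (1 - ∑ b ∈ V, w b) * ((∑ b ∈ K₁ ∩ K₁', w b) - (∑ b ∈ K₁, w b) * (∑ b ∈ K₁', w b)) := mul_nonneg (by linarith) (by linarith)
  have e2 : 0 ≤ (1 - ∑ b ∈ V, w b) * ((∑ b ∈ P₁ ∩ P₁', w b) - (∑ b ∈ P₁, w b) * (∑ b ∈ P₁', w b)) := mul_nonneg (by linarith) (by linarith)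
  have e3 : 0 ≤ (1 - ∑ b ∈ V, w b) * ((∑ b ∈ (P₀ ∩ O₁') ∩ V, w b) - (∑ b ∈ P₀, w b) * (∑ b ∈ O₁' ∩ V, w b)) := mul_nonneg (by linarith) (by linarith)
  have e4 : 0 ≤ (1 - ∑ b ∈ V, w b) * ((∑ b ∈ (O₁ ∩ P₀') ∩ V, w b) - (∑ b ∈ P₀', w b) * (∑ b ∈ O₁ ∩ V, w b)) := mul_nonneg (by linarith) (by linarith)
  have e5 : 0 ≤ (∑ b ∈ V, w b) * ((∑ b ∈ (P₁ ∩ O₁') ∩ V, w b) - (∑ b ∈ P₁, w b) * (∑ b ∈ O₁' ∩ V, w b)) := mul_nonneg hv0 (by linarith)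
  have e6 : 0 ≤ (∑ b ∈ V, w b) * ((∑ b ∈ (O₁ ∩ P₁') ∩ V, w b) - (∑ b ∈ P₁', w b) * (∑ b ∈ O₁ ∩ V, w b)) := mul_nonneg hv0 (by linarith)
  have e7 : 0 ≤ (1 - ∑ b ∈ V, w b) * (((∑ b ∈ K₁, w b) - ∑ b ∈ O₁, w b) * ((∑ b ∈ P₁', w b) - ∑ b ∈ P₀', w b)) := mul_nonneg (by linarith) (mul_nonneg (by linarith) (by linarith))
  have e8 : 0 ≤ (1 - ∑ b ∈ V, w b) * (((∑ b ∈ O₁, w b) - ∑ b ∈ O₁ ∩ V, w b) * ((∑ b ∈ P₁', w b) - ∑ b ∈ P₀', w b)) := mul_nonneg (by linarith) (mul_nonneg (by linarith) (by linarith))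
  have e9 : 0 ≤ (1 - ∑ b ∈ V, w b) * (((∑ b ∈ P₁, w b) - ∑ b ∈ K₁, w b) * ((∑ b ∈ P₁', w b) - ∑ b ∈ K₁', w b)) := mul_nonneg (by linarith) (mul_nonneg (by linarith) (by linarith))
  have e10 : 0 ≤ (1 - ∑ b ∈ V, w b) * (((∑ b ∈ P₁, w b) - ∑ b ∈ P₀, w b) * ((∑ b ∈ K₁', w b) - ∑ b ∈ O₁', w b)) := mul_nonneg (by linarith) (mul_nonneg (by linarith) (by linarith))
  have e11 : 0 ≤ (1 - ∑ b ∈ V, w b) * (((∑ b ∈ P₁, w b) - ∑ b ∈ P₀, w b) * ((∑ b ∈ O₁', w b) - ∑ b ∈ O₁' ∩ V, w b)) := mul_nonneg (by linarith) (mul_nonneg (by linarith) (by linarith))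
  have e12 : 0 ≤ (1 - ∑ b ∈ V, w b) * ((∑ b ∈ (P₀ ∩ P₀') ∩ V, w b) + (∑ b ∈ (O₁ ∩ O₁') ∩ V, w b) - (∑ b ∈ (P₀ ∩ O₁') ∩ V, w b) - (∑ b ∈ (O₁ ∩ P₀') ∩ V, w b)) := mul_nonneg (by linarith) (by linarith)
  have e13 : 0 ≤ (∑ b ∈ V, w b) * ((∑ b ∈ (P₁ ∩ P₁') ∩ V, w b) + (∑ b ∈ (O₁ ∩ O₁') ∩ V, w b) - (∑ b ∈ (P₁ ∩ O₁') ∩ V, w b) - (∑ b ∈ (O₁ ∩ P₁') ∩ V, w b)) := mul_nonneg hv0 (by linarith)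
  have e14 : 0 ≤ (∑ b ∈ V, w b) * ((∑ b ∈ P₁ ∩ P₁', w b) - (∑ b ∈ (P₁ ∩ P₁') ∩ V, w b) - ((∑ b ∈ P₀ ∩ P₀', w b) - (∑ b ∈ (P₀ ∩ P₀') ∩ V, w b))) := mul_nonneg hv0 (by linarith)
  linarith [hx1, hx2, hx3, hmd, hc, hH1, hH2, hH3, hH4, hH5, hH6, hH7, hH8, hH9, hH10, e1, e2, e3, e4, e5, e6, e7, e8, e9, e10, e11, e12, e13, e14, hv0, hv1]


end Summit.CriticalPhenomena.PercolationContinuityZ3.Theorems.SahiE3LevelZ2C2Generic
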